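import Summits.NavierStokesRegularity.FunctionalMining.TopBotEigSplitSharePlanarSector
import Summits.NavierStokesRegularity.FunctionalMining.NoGo.TopBotEigSplitWallOneDim
import Summits.NavierStokesRegularity.FunctionalMining.NoGo.TopBotEigSplitShareClosure
import Summits.NavierStokesRegularity.FunctionalMining.NoGo.TopBotEigSplitShareWallMain
import Summits.NavierStokesRegularity.FunctionalMining.NoGo.TopBotEigHeatCoerciveLtTwo
import Summits.NavierStokesRegularity.FunctionalMining.NoGo.TopBotEigHeatWindow
import HarnessLib

/-!
# FunctionalMining — THE SHARE WINDOW OF DOOR D-K6 (c) BELOW `q = 2`: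
# `{c | TopBotEigSplitting q c} = Iic (((q − 1)/3)·2^{1 − q/2})` for every real `1 < q ≤ 2`

HONEST FRAMING. Search for candidate a priori estimates; no regularity claim. A finite-dimensional statement about
convex functions on flat `3 × 3` tensors; nothing about Navier–Stokes is proved or asserted. Cell `pub-nsfunc`,
prove seat (gen 27); composition file of the planar-share trilogy
(`TopBotEigSplitSharePlanar` → `TopBotEigSplitSharePlanarLine` → `TopBotEigSplitSharePlanarSector` → this file).

THE RESULT. K9's splitting obligation `TopBotEigSplitting q c` (a convex `1`-Lipschitz `h ≥ 0` and `M ≥ 0` with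
`λ(A)^q + λ(−A)^q = M·h(A)^q + c‖A‖^q` on symmetric trace-free `A`) has, for every real `1 < q ≤ 2`, EXACTLY the
shares `c ≤ c_pl(q) = ((q − 1)/3)·2^{1 − q/2}`:
* `⊇`: K19's one-dimensional criterion `topBotEigSplitting_of_line` ((N⁺) ∧ (D) ∧ (W) on `[1/3, 2/3]` ⟹ splitting,
  every real `q ≥ 1`) at `c = c_pl(q)` with (N⁺) `lineN_cPlanar_pos`, (D) `lineD_cPlanar`
  (`TopBotEigSplitSharePlanar`) and (W) `lineT_cPlanar_nonneg_sector` (`TopBotEigSplitSharePlanarSector`), all for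
  `1 < q ≤ 2` — `topBotEigSplitting_cPlanar`; then K20a's downward closure `topBotEigSplitting_of_le`;
* `⊆`: the planar necessity `topBotEigSplitting_share_le_cPlanar` (every real `q > 1`).
So **`topBotEigSplitting_window_cPlanar (hq : 1 < q) (hq2 : q ≤ 2) : {c | TopBotEigSplitting q c} = Iic (cPlanar q)`**,
with `topBotEigSplitting_isGreatest_cPlanar`, `topBotEigSplitting_iff_le_cPlanar`, `sSup_topBotEigSplitting_cPlanar`,
and by value `topBotEigSplitting_three_halves_window : {c | TopBotEigSplitting (3/2) c} = Iic (2^{1/4}/6)`,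
`topBotEigSplitting_seven_quarters_iff : TopBotEigSplitting (7/4) c ↔ c ≤ (1/4)·2^{1/8}`, and at `q = 2` a second
route to K20b's `Iic (1/3)` (`topBotEigSplitting_two_window_planar`, via `cPlanar_two`); and `cPlanar_le_cAxi :
1 < q → q ≤ 2 → cPlanar q ≤ cAxi q` (with K16 `topBotEigSplitting_share_le_cAxi`); and §P7 the door-(c) RATE below `2` at the
sharp share through K12's mixture principle: `topBotEigMoment_heatCoercive_cPlanar : 1 < q → q < 2 →
HeatCoercive (Φ_q + Ψ_q) (cPlanar q · zqRateLtTwo q / 2)` (`zqRateLtTwo q = 2π²q(q − 1)/(51(2 − q/2)²)`), with an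
explicit-witness `example` for the tree node `TopBotEigHeatCoercivePos q` (the node BY NAME is K13c's
`topBotEigHeatCoercivePos_of_lt_two`, from SOME share; this is the best rate K12's route yields, since every share
is `≤ c_pl(q)`), and the
by-name window of the dictionary constant `topBotEigHeatRate_window_lt_two : topBotEigHeatRate q ∈
Icc (cPlanar q · zqRateLtTwo q / 2) (4π²q)` for `1 < q < 2` (K6; K30 is the `q > 2` counterpart).

CONTEXT (door D-K6 (c), records only). Above `q = 2` the window is `Iic (c_axi q)`, binding at the axisymmetric
walls of the test line, proved per exponent (`q = 2, 3, 4, 6, 8`: K20b, K21, K17/K20b, K22, K23) with the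
general-`q` necessity K16; below `q = 2` the census/no-go records had «(W) fails at `c_axi`; `c*(q)` OPEN». This
file: below `2` the window is binding at the PLANAR point of the same line and is `Iic (c_pl q)` uniformly in
`1 < q ≤ 2`; the two ceilings agree at `q = 2` (`c_pl(2) = c_axi(2) = 1/3`, where `T ≡ 0`). READING of the whole
range (records only): `sup {c | TopBotEigSplitting q c} = c_pl(q)` on `(1, 2]` (this file) and `= c_axi(q)` on
`[2, ∞)` (kernel at `q = 2, 3, 4, 6, 8`; K16 ceiling for every `q > 1`), continuous at `q = 2`.

NOT CLAIMED. Nothing on `heatDissipation` / `TopBotEigHeatCoercivePos`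
(door (c) below `2` has a positive share by K13 regardless of the sharp value); no `𝒦₀` row, no count, no numerics
of record; no Navier–Stokes statement. [ours] search for candidate a priori estimates; no regularity claim.
-/

open Set Filter Topology

noncomputable section

namespace Summit.NavierStokesRegularity.FunctionalMining

namespace TopEig

/-! ## P6. THE SHARE WINDOW UP TO `q = 2`: `{c | TopBotEigSplitting q c} = Set.Iic (c_pl q)` for every real
`1 < q ≤ 2` (K19's criterion at the planar share + the planar necessity + K20a's downward closure) -/

/-- **The planar share is ATTAINED, `1 < q ≤ 2`:** `TopBotEigSplitting q (c_pl q)` — K19's one-dimensional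
criterion `topBotEigSplitting_of_line` with (N⁺) `lineN_cPlanar_pos`, (D) `lineD_cPlanar`, (W)
`lineT_cPlanar_nonneg_sector`. [ours] -/
theorem topBotEigSplitting_cPlanar {q : ℝ} (hq : 1 < q) (hq2 : q ≤ 2) :
    TopBotEigSplitting q (cPlanar q) :=
  topBotEigSplitting_of_line hq.le (cPlanar_pos hq).le
    (fun _ h1 h2 => lineN_cPlanar_pos hq hq2 h1 h2)
    (fun _ h1 h2 => lineD_cPlanar hq hq2 h1 h2)
    (fun _ h1 h2 => lineT_cPlanar_nonneg_sector hq hq2 h1 h2)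

/-- **`c_pl(q)` is the GREATEST share, `1 < q ≤ 2`.** [ours] -/
theorem topBotEigSplitting_isGreatest_cPlanar {q : ℝ} (hq : 1 < q) (hq2 : q ≤ 2) :
    IsGreatest {c : ℝ | TopBotEigSplitting q c} (cPlanar q) :=
  ⟨topBotEigSplitting_cPlanar hq hq2, fun _ hc => topBotEigSplitting_share_le_cPlanar hq hc⟩

/-- **THE SHARE WINDOW for every real `1 < q ≤ 2`: `{c | TopBotEigSplitting q c} = Set.Iic (c_pl q)`**,
`c_pl(q) = ((q − 1)/3)·2^{1 − q/2}` — the whole range below `2` in closed form, uniform in `q`, binding at the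
PLANAR point of the test line; at `q = 2` it is K20b's window `Set.Iic (1/3)` by a second route (`cPlanar_two`).
Compare the ladder above `2` (K20b/K21/K17/K22/K23: `Set.Iic (c_axi q)` at `q = 2, 3, 4, 6, 8`, binding at the
axisymmetric walls). Search for candidate a priori estimates; no regularity claim. [ours] -/
theorem topBotEigSplitting_window_cPlanar {q : ℝ} (hq : 1 < q) (hq2 : q ≤ 2) :
    {c : ℝ | TopBotEigSplitting q c} = Set.Iic (cPlanar q) :=
  topBotEigSplitting_window_of_isGreatest hq.le (topBotEigSplitting_isGreatest_cPlanar hq hq2)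

/-- Membership form: `TopBotEigSplitting q c ↔ c ≤ c_pl(q)`, `1 < q ≤ 2`. [ours] -/
theorem topBotEigSplitting_iff_le_cPlanar {q : ℝ} (hq : 1 < q) (hq2 : q ≤ 2) (c : ℝ) :
    TopBotEigSplitting q c ↔ c ≤ cPlanar q :=
  ⟨fun hc => topBotEigSplitting_share_le_cPlanar hq hc,
    fun hc => topBotEigSplitting_of_le hq.le hc (topBotEigSplitting_cPlanar hq hq2)⟩

/-- `sSup {c | TopBotEigSplitting q c} = c_pl(q)`, `1 < q ≤ 2`. [ours] -/
theorem sSup_topBotEigSplitting_cPlanar {q : ℝ} (hq : 1 < q) (hq2 : q ≤ 2) :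
    sSup {c : ℝ | TopBotEigSplitting q c} = cPlanar q :=
  (topBotEigSplitting_isGreatest_cPlanar hq hq2).csSup_eq

/-- By value at `q = 3/2`: the window is `Set.Iic (2^{1/4}/6)` (`2^{1/4}/6 ≈ 0.1982`). [ours] -/
theorem topBotEigSplitting_three_halves_window :
    {c : ℝ | TopBotEigSplitting (3 / 2) c} = Set.Iic ((2 : ℝ) ^ (1 / 4 : ℝ) / 6) := by
  rw [← cPlanar_three_halves]; exact topBotEigSplitting_window_cPlanar (by norm_num) (by norm_num)

/-- By value at `q = 7/4`: `TopBotEigSplitting (7/4) c ↔ c ≤ (1/4)·2^{1/8}`. [ours] -/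
theorem topBotEigSplitting_seven_quarters_iff (c : ℝ) :
    TopBotEigSplitting (7 / 4) c ↔ c ≤ 1 / 4 * (2 : ℝ) ^ (1 / 8 : ℝ) := by
  have h : cPlanar (7 / 4) = 1 / 4 * (2 : ℝ) ^ (1 / 8 : ℝ) := by
    rw [cPlanar, show (1 : ℝ) - 7 / 4 / 2 = 1 / 8 by norm_num]; ring
  rw [← h]; exact topBotEigSplitting_iff_le_cPlanar (by norm_num) (by norm_num) c

/-- By value at `q = 2`, second route to K20b's window: `{c | TopBotEigSplitting 2 c} = Set.Iic (1/3)`. [ours] -/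
theorem topBotEigSplitting_two_window_planar : {c : ℝ | TopBotEigSplitting 2 c} = Set.Iic (1 / 3 : ℝ) := by
  rw [← cPlanar_two]; exact topBotEigSplitting_window_cPlanar (by norm_num) le_rfl

/-- **The planar ceiling lies below the axisymmetric one on `(1, 2]`:** `c_pl(q) ≤ c_axi(q)` for `1 < q ≤ 2`
(the planar share is attained, and every share is `≤ c_axi(q)` by K16 `topBotEigSplitting_share_le_cAxi`); equality
at `q = 2` (`1/3`). [ours] -/
theorem cPlanar_le_cAxi {q : ℝ} (hq : 1 < q) (hq2 : q ≤ 2) : cPlanar q ≤ cAxi q :=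
  topBotEigSplitting_share_le_cAxi hq (topBotEigSplitting_cPlanar hq hq2)

/-! ## P7. Door D-K6 (c) below `q = 2` with the SHARP share: the heat-coercivity rate of `Φ_q + Ψ_q` through
K12's mixture principle at `c = c_pl(q)` -/

/-- **`HeatCoercive (Φ_q + Ψ_q) (c_pl(q)·c_Z(q)/2)` for every real `1 < q < 2`** — K12
`topBotEigMoment_heatCoercive_of_splitting_of_lt_two` at the attained planar share (`c_Z(q) = zqRateLtTwo q =
2π²q(q − 1)/(51(2 − q/2)²)`); since every splitting share is `≤ c_pl(q)`, this is the best rate K12's route can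
give. Search for candidate a priori estimates; no regularity claim. [ours] -/
theorem topBotEigMoment_heatCoercive_cPlanar {q : ℝ} (hq1 : 1 < q) (hq2 : q < 2) :
    HeatCoercive (d := Fin 3) (topBotEigMoment q) (cPlanar q * zqRateLtTwo q / 2) :=
  topBotEigMoment_heatCoercive_of_splitting_of_lt_two hq1 hq2 (cPlanar_pos hq1).le
    (topBotEigSplitting_cPlanar hq1 hq2.le)

/- The explicit witness behind the tree node `TopBotEigHeatCoercivePos q`, `1 < q < 2`: rate
`((q − 1)/3)·2^{1−q/2}·π²q(q − 1)/(51(2 − q/2)²) > 0`. Kept as an `example` only: the node BY NAME on `1 < q < 2`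
is K13c's `topBotEigHeatCoercivePos_of_lt_two` (`NoGo/TopBotEigHeatCoerciveGtOne`, from SOME share via K13b);
this is the same statement with the sharp-share witness. [ours; bookkeeping, declares nothing] -/
example {q : ℝ} (hq1 : 1 < q) (hq2 : q < 2) :
    TopBotEigHeatCoercivePos (d := Fin 3) q :=
  ⟨cPlanar q * zqRateLtTwo q / 2,
    by have := zqRateLtTwo_pos hq1 (by linarith : q < 4); have := cPlanar_pos hq1; positivity,
    topBotEigMoment_heatCoercive_cPlanar hq1 hq2⟩

/-- **The dictionary's door-(c) constant below `2`:** `c_pl(q)·c_Z(q)/2 ≤ C^sym_λ(q) = topBotEigHeatRate q ≤ 4π²q`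
for every real `1 < q < 2` (the lower end = §P7 through K6 `topBotEigHeatCoercive_iff_le_rate`, the upper end = K6
`topBotEigHeatRate_le`; the no-go seat's K30 is the `q > 2` counterpart at the attained axisymmetric share).
Search for candidate a priori estimates; no regularity claim. [ours; records only] -/
theorem topBotEigHeatRate_window_lt_two {q : ℝ} (hq1 : 1 < q) (hq2 : q < 2) :
    topBotEigHeatRate q ∈ Set.Icc (cPlanar q * zqRateLtTwo q / 2) (4 * Real.pi ^ 2 * q) :=
  ⟨(topBotEigHeatCoercive_iff_le_rate hq1.le).1 (topBotEigMoment_heatCoercive_cPlanar hq1 hq2),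
    topBotEigHeatRate_le hq1.le⟩

end TopEig

end Summit.NavierStokesRegularity.FunctionalMining

end
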